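import Literature.Computability.AlgebraicComplexity.PITLanguageSlotSem
import Literature.Computability.AlgebraicComplexity.CircuitCodeReading
import Literature.Computability.Complexity.RPClosureProofs
import Literature.Computability.Complexity.CodeFPArith
import HarnessLib

/-!
# `PITLanguage ≤ₚ {w | semPoly w = 0}`: the full identity-testing language reduced to the zero set of
# the junk-tolerant circuit-code semantics (modulo a polynomial-time decoder)

Topic `Computability/AlgebraicComplexity`. The tree's junk-tolerant reading of circuit codes
(`CircuitCode.rdCircuit V w`, `CircuitCode.semPoly w`, `CircuitCodeReading.lean`) assigns to EVERY
string a polynomial in `|w|` variables; on a genuine code word `circuitWord m C` with `m ≤ |code|` it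
is `C.eval` renamed (`CircuitCode.semPoly_circuitWord_eq_zero_iff`), and the randomised modular zero
test (`ModularZeroTest.mem_coRP_of_modularZeroTest`) is built to put `{w | semPoly w = 0}` in `coRP`.
The language `PITLanguage` itself (Kabanets–Impagliazzo's ACIT: ALL code words `⟨bin n, code C⟩`, the
number `n` of variables possibly exponential in the code length) Karp-reduces to that zero set, hence
inherits `coRP` / `BPP` (`mem_coRP_of_karpReducible`, `RPClosureProofs.lean`; `mem_BPP_of_karpReducible`).
The reduction COMPRESSES the variables: a circuit reads at most `edgeSize + 1` variables
(`ArithCircuit.slot`, `PITLanguageSlotSem.lean`), so renaming `x_i ↦ x_{slot i}` gives a circuit over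
`V = |operands| ≤ |code|` variables computing zero iff `C` does; non-code-words go to a fixed word
outside the zero set (a canonicity test is necessary: a non-code-word may READ as a zero circuit).

* `ArithCircuit.slotIdx`, `ArithCircuit.compress` (`C.rename slotIdx`, over `Fin |C.operands|`),
  `ArithCircuit.eval_compress_eq_zero_iff`, `ArithCircuit.length_operands_compress`;
* `pitCompress ⟨n, C⟩ = ⟨|C.operands|, compress C⟩`, `semPoly_circuitWord_compress_eq_zero_iff`;
* `karpReducible_of_decoder_of_codeFP` — the generic decoder pattern of
  `BILPS19Thm34.karpReducible_of_decoder` (Barriers/…/BILPS19HMinRank1ToHQuadProofs.lean) for a target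
  LANGUAGE given directly on strings rather than through an encoding;
* **`PITLanguage_karpReducible_semPolyZero`** — `PITLanguage ≤ₚ {w | semPoly w = 0}` GIVEN (i) a total
  decoder `dec` of `pitInstanceEncoding` whose re-encoding `w ↦ encode (dec w)` is polynomial time
  (`CodeFP strE encode dec`) and (ii) `pitCompress` in polynomial time on codes (`CodeFP encode encode`)
  — the two WRITER machines, not built here;
* **`PITLanguage_mem_coRP_of_semPolyZero`**, **`PITLanguage_mem_BPP_of_semPolyZero`** — then
  `{w | semPoly w = 0} ∈ coRP` (resp. `BPP`) gives `PITLanguage ∈ coRP` (resp. `BPP`).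

No machine and no named fact here. Honest framing: bookkeeping towards the textbook `ACIT ∈ coRP`
(Schwartz 1980; Ibarra–Moran 1983; Kabanets–Impagliazzo 2004, Lemma 2.2); nothing bears on `VP ≠ VNP`.

## References

* [KabanetsImpagliazzo2004] V. Kabanets, R. Impagliazzo, Comput. Complexity 13 (2004) 1–46, §2
  (ACIT; Lemma 2.2: ACIT ∈ coRP).
* [Schwartz1980] J. T. Schwartz, J. ACM 27 (1980) 701–717, §3.
* [AroraBarakCC2009] S. Arora, B. Barak, *Computational Complexity: A Modern Approach*, CUP 2009,
  §2.1 (Karp reductions), Lemma 7.5, §7.2.3, §7.6.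
-/

noncomputable section

open MvPolynomial Computability
open Literature.Computability.Complexity Literature.Computability.Complexity.CodeFP
open scoped Literature.Computability.Complexity.Notation

namespace Literature.Computability.AlgebraicComplexity

/-! ## Compressing the variables of a circuit onto its operand positions -/

namespace ArithCircuit

variable {n : ℕ}

/-- The operand list is nonempty (it ends with the output operand). [cite: Burgisser2000, Def. 2.1] -/
theorem length_operands_pos (C : ArithCircuit ℤ (Fin n)) : 0 < C.operands.length := by
  rw [length_operands]; exact Nat.succ_pos _

/-- The slot of `x_i` as an index below the number of operand occurrences (clamped; no clamping for a
variable that is read). [cite: KabanetsImpagliazzo2004, §2] -/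
def slotIdx (C : ArithCircuit ℤ (Fin n)) (i : Fin n) : Fin C.operands.length :=
  ⟨min (C.slot i) (C.operands.length - 1), by have := C.length_operands_pos; omega⟩

/-- On a variable that is read, `slotIdx` is the slot. [cite: KabanetsImpagliazzo2004, §2] -/
theorem val_slotIdx_of_mem_varSet (C : ArithCircuit ℤ (Fin n)) {i : Fin n} (hi : i ∈ C.varSet) :
    (C.slotIdx i : ℕ) = C.slot i := by
  have h : C.slot i < C.operands.length :=
    List.idxOf_lt_length_of_mem ((C.mem_varSet_iff_mem_operands i).1 hi)
  change min (C.slot i) (C.operands.length - 1) = C.slot i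
  omega

/-- `slotIdx` is injective on the variables read. [cite: KabanetsImpagliazzo2004, §2] -/
theorem slotIdx_injOn (C : ArithCircuit ℤ (Fin n)) : Set.InjOn C.slotIdx ↑C.varSet := by
  intro i hi j hj h
  have h' := congrArg Fin.val h
  rw [C.val_slotIdx_of_mem_varSet hi, C.val_slotIdx_of_mem_varSet hj] at h'
  exact C.slot_injOn hi hj h'

/-- **The compressed circuit**: `C` with `x_i` renamed to `x_{slot i}`, over `|operands| = edgeSize + 1`
variables. [cite: KabanetsImpagliazzo2004, §2] -/
def compress (C : ArithCircuit ℤ (Fin n)) : ArithCircuit ℤ (Fin C.operands.length) := C.rename C.slotIdx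

/-- **Compression preserves vanishing**: `(compress C).eval = 0 ↔ C.eval = 0` (the renaming is
injective on the variables of `C.eval`). [cite: Schwartz1980, §3] -/
theorem eval_compress_eq_zero_iff (C : ArithCircuit ℤ (Fin n)) : (C.compress).eval = 0 ↔ C.eval = 0 := by
  rw [compress, eval_rename_apply]
  exact rename_eq_zero_iff_of_injOn_vars ((C.slotIdx_injOn).mono (by exact_mod_cast C.vars_eval_subset))

/-- Renaming does not change the operand list up to renaming. [cite: Burgisser2000, Def. 2.1] -/
theorem operands_rename {σ τ : Type*} (e : σ → τ) (C : ArithCircuit ℤ σ) :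
    (C.rename e).operands = C.operands.map (Operand.rename e) := by
  have hg : ∀ g : Gate ℤ σ, (g.rename e).args = g.args.map (Operand.rename e) := by
    intro g
    cases g with
    | sum args => simp [Gate.rename, Gate.args, List.map_map, Function.comp_def]
    | prod args => simp [Gate.rename, Gate.args]
  simp only [operands, rename, List.map_append, List.map_cons, List.map_nil, List.flatMap_map]
  congr 1
  rw [List.map_flatMap]
  exact List.flatMap_congr fun g _ => hg g

/-- The compressed circuit has as many operand occurrences. [cite: Burgisser2000, Def. 2.1] -/
theorem length_operands_compress (C : ArithCircuit ℤ (Fin n)) :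
    C.compress.operands.length = C.operands.length := by
  rw [compress, operands_rename, List.length_map]

end ArithCircuit

/-! ## The compressed instance and its circuit word -/

section Compress

open ArithCircuit CircuitCode KIReduction

/-- **The compressed instance** `⟨|C.operands|, compress C⟩` of an identity-test instance `⟨n, C⟩`.
[cite: KabanetsImpagliazzo2004, §2] -/
def pitCompress (p : Σ n : ℕ, ArithCircuit ℤ (Fin n)) : Σ V : ℕ, ArithCircuit ℤ (Fin V) :=
  ⟨p.2.operands.length, p.2.compress⟩

/-- `circuitWord` is the instance encoding. [cite: KabanetsImpagliazzo2004, §2] -/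
theorem circuitWord_eq_encode (m : ℕ) (C : ArithCircuit ℤ (Fin m)) :
    circuitWord m C = pitInstanceEncoding.encode ⟨m, C⟩ := rfl

/-- The number of variables of the compressed instance fits in its code word. [cite: KabanetsImpagliazzo2004, §2] -/
theorem width_le_length_circuitWord_compress {n : ℕ} (C : ArithCircuit ℤ (Fin n)) :
    C.operands.length ≤ (circuitWord C.operands.length C.compress).length := by
  have h1 := C.compress.length_operands_le_length_encode
  rw [C.length_operands_compress] at h1
  refine h1.trans ?_
  rw [circuitWord, length_boolPair]; omega

/-- **The zero set of `semPoly` agrees with `PITLanguage` on compressed code words.**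
[cite: Schwartz1980, §3] [cite: KabanetsImpagliazzo2004, §2] -/
theorem semPoly_circuitWord_compress_eq_zero_iff {n : ℕ} (C : ArithCircuit ℤ (Fin n)) :
    semPoly (circuitWord C.operands.length C.compress) = 0 ↔ C.eval = 0 := by
  rw [semPoly_circuitWord_eq_zero_iff _ (width_le_length_circuitWord_compress C), eval_compress_eq_zero_iff]

/-- The polynomial of the rejected word `badWord = circuitWord 0 (ofConst 1)` is not zero.
[cite: KabanetsImpagliazzo2004, §2] -/
theorem semPoly_badWord_ne_zero : semPoly badWord ≠ 0 := by
  rw [badWord, Ne, semPoly_circuitWord_eq_zero_iff _ (Nat.zero_le _), eval_ofConst]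
  exact one_ne_zero

end Compress

/-! ## The Karp reduction, modulo the decoder and the compression writer -/

section Reduction

open CircuitCode KIReduction

/-- **A Karp reduction presented through a total decoder, target a language of strings**: if
`dec : {0,1}* → α` inverts the encoding, the re-encoding `w ↦ code (dec w)` and the map
`a ↦ out a ∈ {0,1}*` are polynomial time on codes, `out` sends `S` into `T` and its complement into
the complement, and `bad ∉ T`, then `code(S) ≤ₚ T` — by the string function "if `w` re-encodes to
itself then `out (dec w)` else `bad`" (variant of `BILPS19Thm34.karpReducible_of_decoder`, whose target
is an encoded set). [cite: AroraBarakCC2009, §2.1 (Def. 2.7)] -/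
theorem karpReducible_of_decoder_of_codeFP {α : Type} (eα : Encoding α Bool)
    {dec : List Bool → α} (hdec : ∀ a, dec (eα.encode a) = a) (hdecFP : CodeFP strE eα.encode dec)
    {out : α → List Bool} (hout : CodeFP eα.encode strE out) {S : Set α} {T : Language Bool}
    (hST : ∀ a, a ∈ S ↔ out a ∈ T) {bad : List Bool} (hbad : bad ∉ T) :
    eα.toLanguage S ≤ₚ T := by
  classical
  have hre : CodeFP strE strE (fun w => eα.encode (dec w)) := hdecFP.recodeOut fun _ => rfl
  have htest : CodeFP strE bitE (fun w => decide (eα.encode (dec w) = w)) :=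
    ((CodeFP.eq (eα := strE) fun _ _ h => h).comp (hre.pair (CodeFP.id strE))).congr fun _ => rfl
  have hout' : CodeFP strE strE (fun w => out (dec w)) := hout.comp hdecFP
  obtain ⟨f, hf, hfF⟩ := htest.ite hout' (const strE (eβ := strE) bad)
  refine ⟨f, hf, fun w => ?_⟩
  have hfw : f w = if decide (eα.encode (dec w) = w) then out (dec w) else bad := hfF w
  show w ∈ eα.toLanguage S ↔ f w ∈ T
  rw [hfw]
  by_cases hw : eα.encode (dec w) = w
  · rw [decide_eq_true hw, if_pos rfl, ← hST, ← hw, Encoding.mem_toLanguage_iff, hdec]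
  · rw [decide_eq_false hw]
    refine ⟨fun h => ?_, fun h => (hbad h).elim⟩
    obtain ⟨a, -, rfl⟩ := h
    exact (hw (by rw [hdec])).elim

/-- **`PITLanguage ≤ₚ {w | semPoly w = 0}`, modulo the two writer machines**: given a total decoder
`dec` of `pitInstanceEncoding` with polynomial-time re-encoding and the compression `pitCompress` in
polynomial time on codes, the identity-testing language of ALL integer circuit codes Karp-reduces to the
zero set of the junk-tolerant code semantics (`w ↦ circuitWord |operands| (compress C)` on code words,
`badWord` elsewhere). [cite: KabanetsImpagliazzo2004, §2 and Lemma 2.2] [cite: Schwartz1980, §3] -/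
theorem PITLanguage_karpReducible_semPolyZero
    {dec : List Bool → Σ n : ℕ, ArithCircuit ℤ (Fin n)}
    (hdec : ∀ p, dec (pitInstanceEncoding.encode p) = p)
    (hdecFP : CodeFP strE pitInstanceEncoding.encode dec)
    (hcompFP : CodeFP pitInstanceEncoding.encode pitInstanceEncoding.encode pitCompress) :
    PITLanguage ≤ₚ ({w | semPoly w = 0} : Language Bool) := by
  rw [PITLanguage_eq_toLanguage]
  refine karpReducible_of_decoder_of_codeFP pitInstanceEncoding hdec hdecFP
    (out := fun p => pitInstanceEncoding.encode (pitCompress p)) (hcompFP.recodeOut fun _ => rfl)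
    (fun p => ?_) semPoly_badWord_ne_zero
  obtain ⟨n, C⟩ := p
  change C.eval = 0 ↔ semPoly (pitInstanceEncoding.encode (pitCompress ⟨n, C⟩)) = 0
  rw [pitCompress, ← circuitWord_eq_encode, semPoly_circuitWord_compress_eq_zero_iff]

/-- **`PITLanguage ∈ coRP`** from the two writers and `{w | semPoly w = 0} ∈ coRP` (the randomised
modular zero test on the junk-tolerant semantics), by `mem_coRP_of_karpReducible`.
[cite: KabanetsImpagliazzo2004, Lemma 2.2] [cite: AroraBarakCC2009, §7.6] -/
theorem PITLanguage_mem_coRP_of_semPolyZero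
    {dec : List Bool → Σ n : ℕ, ArithCircuit ℤ (Fin n)}
    (hdec : ∀ p, dec (pitInstanceEncoding.encode p) = p)
    (hdecFP : CodeFP strE pitInstanceEncoding.encode dec)
    (hcompFP : CodeFP pitInstanceEncoding.encode pitInstanceEncoding.encode pitCompress)
    (hB : ({w | semPoly w = 0} : Language Bool) ∈ coRP) : PITLanguage ∈ coRP :=
  mem_coRP_of_karpReducible (PITLanguage_karpReducible_semPolyZero hdec hdecFP hcompFP) hB

/-- **`PITLanguage ∈ BPP`** from the two writers and `{w | semPoly w = 0} ∈ BPP`, by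
`mem_BPP_of_karpReducible`. [cite: KabanetsImpagliazzo2004, Lemma 2.2] [cite: AroraBarakCC2009, §7.6] -/
theorem PITLanguage_mem_BPP_of_semPolyZero
    {dec : List Bool → Σ n : ℕ, ArithCircuit ℤ (Fin n)}
    (hdec : ∀ p, dec (pitInstanceEncoding.encode p) = p)
    (hdecFP : CodeFP strE pitInstanceEncoding.encode dec)
    (hcompFP : CodeFP pitInstanceEncoding.encode pitInstanceEncoding.encode pitCompress)
    (hB : ({w | semPoly w = 0} : Language Bool) ∈ BPP) : PITLanguage ∈ BPP :=
  mem_BPP_of_karpReducible (PITLanguage_karpReducible_semPolyZero hdec hdecFP hcompFP) hB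

end Reduction

end Literature.Computability.AlgebraicComplexity
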